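import Mathlib
import Summits.NavierStokesRegularity.OSWSelfSimilar.SheetNSLineTorusCascadeThreshold
import Summits.NavierStokesRegularity.OSWSelfSimilar.SheetNSLineTorusCascadeLinkGeneral
import HarnessLib

/-!
# Viscous CLM on the torus (`a = 0`, `σ = 2`): THE SHARP-THRESHOLD THEOREM FOR THE SINE DATUM — global and unique below
# `κ*ν`, no classical solution past `log(c/(8ν))/ν` above `κ*ν`

HONEST FRAMING (cell ns-blowup GROUP B «PROFILE SEARCH», zone Z3, row Z3-U addendum A-F2 of `HOME/profile/z3/CENSUS-Z3.md`;
human rulings D-0035/D-0074; Z3-TWIN lineage, eng-5 g14): **1-D MODEL (viscous Constantin–Lax–Majda equation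
`ω_t = ω Hω + ν ω_xx` on `𝕋`, `H = hilbertTransformCircle`); real analysis on the Fourier cascade composed with eng-3's
classical-solution link / synthesis, kernel-checked; not Euler, not Navier–Stokes; «violates: none — MODEL»; `κ*` is a constant of the
MODEL, not of any fluid equation.**

OBJECTS: `criticalConstant` (`κ*`) and `thresholdSet` of `SheetNSLineTorusCascadeThreshold` (with `494/25 ≤ κ* ≤ 1983/100` and the
«no delayed blow-up» lemma `le_criticalConstant_of_window`); the solution class `IsClassicalSolution` and the cascade variables
`coef` of `SheetNSLineTorusCascadeLinkModes`; the synthesized series `synthOmega` (`SheetNSLineTorusCascadeSynthesisSeries`).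

THEOREMS (all `ν > 0`).
* `exists_abs_coef_re_le_uniform` — a classical solution on `[0, T]` bounds its cascade variables UNIFORMLY on the compact window
  (joint continuity on `[0,T] × [0,2π]` + periodicity); `coef_re_eq_cascadeSolution` — from the sine datum they ARE the explicit cascade
  `ν (c/ν)^k E_k(νt)` (`isSineCascadeOn_coef_re` + `exists_extend` + `eq_cascadeSolution`);
* `horizon_lt_of_sine_bound` — cascade level: if the explicit sine cascade with `c > κ*ν` is bounded on `[0, T] × ℕ` then
  `T < log(c/(8ν))/ν` (window ⇒ `c/ν ≤ κ*` by `le_criticalConstant_of_window`);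
* **BELOW — `isClassicalSolution_of_lt_critical`, `exists_global_classicalSolution_of_lt_critical`, `eq_synth_of_lt_critical`:** for
  `0 ≤ c < κ*ν` the series of `cascadeSolution ν (sineDatum c)` is a classical `2π`-periodic solution from `−c sin x` on `[0, T]` for
  EVERY `T`, and every classical solution on `[0, T]` from that datum coincides with it (eng-3's `isClassicalSolution_synth` /
  `IsClassicalSolution.eq_synth_of_envelope` fed with the envelope `A·k·(c/(νκ))^k` of a member `κ ∈ thresholdSet`, `c/ν < κ`);
* **ABOVE — `horizon_lt_of_critical_lt`:** for `c > κ*ν` every classical solution on `[0, T]` from `−c sin x` has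
  **`T < log(c/(8ν))/ν`** (uniform, explicit: blow-up happens before the receding pole clears the unit circle);
  `not_global_of_critical_lt`; `horizon_lt_of_critical_lt_gen` — the same horizon for every odd datum `−Σ a_k sin kx` with `a_k ≥ 0`,
  zero mean and `a₁ > κ*ν` (eng-3's comparison `sine_le_coef_re`);
* **`global_iff_lt_critical`** (`c ≠ κ*ν`) and the one-citation form **`sine_datum_dichotomy`**.

bears_on: LADDER-NS N5 / zone Z3 (row Z3-U, A-F2 (t1) datum-free tier, dichotomy form) → N1 linear core. WHAT THIS IS NOT: not NS;
the case `c = κ*ν` is NOT decided; no digit of `κ*` beyond `[19.76, 19.83]`; the located `19.7756ν` and the script-certified interval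
are estimates / enclosures of `κ*ν` from distinct tiers, unchanged. No definitions in this file.
-/

noncomputable section

namespace Summit.NavierStokesRegularity.OSWSelfSimilar
namespace SheetNSLineTorusCascade

open Finset Real Set Filter MeasureTheory intervalIntegral Complex
open Literature.Analysis.Fourier
open scoped Topology

variable {ν c T : ℝ} {ω ωt ωx ωxx : ℝ → ℝ → ℝ}

/-! ### A classical solution bounds its cascade variables uniformly on the compact time window -/

/-- Uniform sup bound of a classical solution on `[0, T] × ℝ` (compactness of `[0,T] × [0,2π]` and periodicity). [folklore] -/
theorem exists_abs_le_uniform (h : IsClassicalSolution ν T ω ωt ωx ωxx) :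
    ∃ B : ℝ, ∀ t ∈ Icc (0 : ℝ) T, ∀ x : ℝ, |ω t x| ≤ B := by
  have hK : IsCompact (Icc (0 : ℝ) T ×ˢ Icc (0 : ℝ) (2 * π)) := isCompact_Icc.prod isCompact_Icc
  have hcont : ContinuousOn (Function.uncurry ω) (Icc (0 : ℝ) T ×ˢ Icc (0 : ℝ) (2 * π)) :=
    h.cont.mono (Set.prod_mono le_rfl (Set.subset_univ _))
  obtain ⟨B, hB⟩ := hK.exists_bound_of_continuousOn hcont
  refine ⟨B, fun t ht x => ?_⟩
  obtain ⟨y, hy, hxy⟩ := (h.periodic t ht).exists_mem_Ico₀ (by positivity : (0 : ℝ) < 2 * π) x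
  have hb := hB (t, y) ⟨ht, Ico_subset_Icc_self hy⟩
  rw [hxy, ← Real.norm_eq_abs]
  exact hb

/-- Uniform bound on the window modes: `‖mode ω m t‖ ≤ 2π·sup|ω|` for all `t ∈ [0, T]`, all `m`. [new here — MODEL] -/
theorem exists_norm_mode_le_uniform (h : IsClassicalSolution ν T ω ωt ωx ωxx) :
    ∃ M : ℝ, ∀ t ∈ Icc (0 : ℝ) T, ∀ m : ℤ, ‖mode ω m t‖ ≤ M := by
  obtain ⟨B, hB⟩ := exists_abs_le_uniform h
  refine ⟨B * |2 * π - 0|, fun t ht m => ?_⟩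
  unfold mode modeCoeff
  refine intervalIntegral.norm_integral_le_of_norm_le_const fun x _ => ?_
  rw [norm_mul, Complex.norm_real, Real.norm_eq_abs]
  have h1 : ‖fourier (-m) (x : AddCircle (2 * π))‖ = 1 := by
    rw [fourier_coe_apply, show 2 * π * I * (-m : ℤ) * x / (2 * π : ℝ) = (((2 * π * (-m : ℤ) * x / (2 * π)) : ℝ) : ℂ) * I
      by push_cast; ring, Complex.norm_exp_ofReal_mul_I]
  rw [h1, one_mul]
  exact hB t ht x

/-- **Uniform bound on the real cascade variables of a classical solution on `[0, T]`.** [new here — MODEL] -/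
theorem exists_abs_coef_re_le_uniform (h : IsClassicalSolution ν T ω ωt ωx ωxx) :
    ∃ M : ℝ, ∀ t ∈ Icc (0 : ℝ) T, ∀ k : ℕ, |(coef ω k t).re| ≤ M := by
  obtain ⟨M, hM⟩ := exists_norm_mode_le_uniform h
  refine ⟨‖-(I / (π : ℂ))‖ * M, fun t ht k => ?_⟩
  calc |(coef ω k t).re| ≤ ‖coef ω k t‖ := Complex.abs_re_le_norm _
    _ = ‖-(I / (π : ℂ))‖ * ‖mode ω k t‖ := by rw [coef, norm_mul]
    _ ≤ ‖-(I / (π : ℂ))‖ * M := by gcongr; exact hM t ht k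

/-- **From the sine datum the real cascade variables ARE the explicit cascade** on `[0, T]` (`T > 0`):
`Re c_k(t) = cascadeSolution ν (sineDatum c) k t`. [new here — MODEL] -/
theorem coef_re_eq_cascadeSolution (h : IsClassicalSolution ν T ω ωt ωx ωxx) (hω0 : ∀ x, ω 0 x = -c * Real.sin x)
    (hT : 0 < T) (k : ℕ) {t : ℝ} (ht : t ∈ Icc (0 : ℝ) T) :
    (coef ω k t).re = cascadeSolution ν (sineDatum c) k t := by
  obtain ⟨G, hG, hGe⟩ := (isSineCascadeOn_coef_re h hω0 hT).exists_extend hT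
  rw [← hGe k t ht, hG.eq_cascadeSolution k t ht.1]

/-! ### The window argument at the cascade level -/

/-- **A bound on the explicit sine cascade over `[0, T]` is a window bound for the universal family:**
`cascadeSolution ν (sineDatum c) k t ≤ B` on `[0, T]` ⇒ `(c/ν)^k E_k(τ) ≤ B/ν` on `[0, νT]`. [new here — MODEL] -/
theorem universal_window_of_sine_bound (hν : 0 < ν) {B : ℝ}
    (hS : ∀ k : ℕ, ∀ t ∈ Icc (0 : ℝ) T, cascadeSolution ν (sineDatum c) k t ≤ B) :
    ∀ k : ℕ, ∀ τ ∈ Icc (0 : ℝ) (ν * T), (c / ν) ^ k * cascadeSolution 1 (sineDatum 1) k τ ≤ B / ν := by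
  intro k τ hτ
  have ht : τ / ν ∈ Icc (0 : ℝ) T :=
    ⟨div_nonneg hτ.1 hν.le, by rw [div_le_iff₀ hν]; linarith [hτ.2, mul_comm ν T]⟩
  have h1 := hS k (τ / ν) ht
  have hντ : ν * (τ / ν) = τ := by field_simp
  rw [cascadeSolution_sine_eq_universal hν c k (τ / ν) ht.1, hντ] at h1
  rw [le_div_iff₀ hν]
  calc (c / ν) ^ k * cascadeSolution 1 (sineDatum 1) k τ * ν
      = ν * (c / ν) ^ k * cascadeSolution 1 (sineDatum 1) k τ := by ring
    _ ≤ B := h1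

/-- **CASCADE LEVEL: above `κ*ν` the explicit sine cascade cannot stay bounded on `[0, log(c/(8ν))/ν]`.** If `c > κ*ν` and
`cascadeSolution ν (sineDatum c) k t ≤ B` for all `k` and all `t ∈ [0, T]`, then `T < log(c/(8ν))/ν`. [new here — MODEL] -/
theorem horizon_lt_of_sine_bound (hν : 0 < ν) (hlt : criticalConstant * ν < c) {B : ℝ}
    (hS : ∀ k : ℕ, ∀ t ∈ Icc (0 : ℝ) T, cascadeSolution ν (sineDatum c) k t ≤ B) :
    T < Real.log (c / (8 * ν)) / ν := by
  by_contra hcon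
  have hle : Real.log (c / (8 * ν)) / ν ≤ T := not_lt.mp hcon
  have hκ : criticalConstant < c / ν := by rwa [lt_div_iff₀ hν]
  have hwin := universal_window_of_sine_bound (c := c) (T := T) hν hS
  have hlog : Real.log (c / ν / 8) = Real.log (c / (8 * ν)) := by rw [div_div, mul_comm]
  have hsub : ∀ k : ℕ, ∀ τ ∈ Icc (0 : ℝ) (Real.log (c / ν / 8)),
      (c / ν) ^ k * cascadeSolution 1 (sineDatum 1) k τ ≤ B / ν := by
    intro k τ hτ
    refine hwin k τ ⟨hτ.1, ?_⟩
    have h2 : Real.log (c / (8 * ν)) ≤ ν * T := by rw [div_le_iff₀ hν] at hle; linarith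
    linarith [hτ.2, hlog]
  exact absurd (le_criticalConstant_of_window hsub) (not_le.mpr hκ)

/-! ### BELOW `κ*ν`: global classical solution, unique on every horizon -/

/-- **Geometric envelope below the critical constant.** For `ν > 0`, `0 ≤ c < κ*ν` there are `A ≥ 0` and `0 ≤ q < 1` with
`|cascadeSolution ν (sineDatum c) k t| ≤ A·k·q^k` for all `k`, `t ≥ 0` (`q = c/(νκ)` for a member `κ ∈ thresholdSet` above `c/ν`).
[new here — MODEL] -/
theorem envelope_of_lt_critical (hν : 0 < ν) (hc : 0 ≤ c) (hlt : c < criticalConstant * ν) :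
    ∃ A q : ℝ, 0 ≤ A ∧ 0 ≤ q ∧ q < 1 ∧
      ∀ k : ℕ, ∀ t : ℝ, 0 ≤ t → |cascadeSolution ν (sineDatum c) k t| ≤ A * k * q ^ k := by
  have hcν : c / ν < criticalConstant := by rwa [div_lt_iff₀ hν]
  obtain ⟨κ, hκS, hcκ⟩ := exists_mem_thresholdSet_of_lt hcν
  obtain ⟨-, C, hC⟩ := hκS
  have hκ : 0 < κ := lt_of_le_of_lt (div_nonneg hc hν.le) hcκ
  have hC0 : 0 ≤ C := thresholdSet_const_nonneg hC
  have hcκν : c < ν * κ := by rw [div_lt_iff₀ hν] at hcκ; linarith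
  refine ⟨ν * C, c / (ν * κ), by positivity, by positivity, (div_lt_one (by positivity)).mpr hcκν, fun k t ht => ?_⟩
  rw [abs_of_nonneg (nonneg (isSineCascade_cascadeSolution ν c) hc k t ht),
    cascadeSolution_sine_eq_universal hν c k t ht]
  rcases Nat.eq_zero_or_pos k with hk | hk
  · subst hk
    simp
  · have hk1 : (1 : ℝ) ≤ k := by exact_mod_cast hk
    have hE := hC k (ν * t) (by positivity)
    have hid : ν * (c / ν) ^ k * cascadeSolution 1 (sineDatum 1) k (ν * t)
        = ν * (c / (ν * κ)) ^ k * (κ ^ k * cascadeSolution 1 (sineDatum 1) k (ν * t)) := by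
      have hκk : κ ^ k ≠ 0 := pow_ne_zero k hκ.ne'
      rw [div_mul_eq_div_div, div_pow (c / ν) κ]
      field_simp
    rw [hid]
    have hq0 : 0 ≤ ν * (c / (ν * κ)) ^ k := by positivity
    calc ν * (c / (ν * κ)) ^ k * (κ ^ k * cascadeSolution 1 (sineDatum 1) k (ν * t))
        ≤ ν * (c / (ν * κ)) ^ k * C := mul_le_mul_of_nonneg_left hE hq0
      _ = ν * C * 1 * (c / (ν * κ)) ^ k := by ring
      _ ≤ ν * C * (k : ℝ) * (c / (ν * κ)) ^ k := by gcongr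

/-- **GLOBAL CLASSICAL SOLUTION BELOW `κ*ν`.** For `ν > 0` and `0 ≤ c < κ*ν` the series of the explicit sine cascade is a classical
`2π`-periodic solution of the MODEL PDE on `[0, T] × ℝ` for EVERY `T`. [new here — MODEL] -/
theorem isClassicalSolution_of_lt_critical (hν : 0 < ν) (hc : 0 ≤ c) (hlt : c < criticalConstant * ν) (T : ℝ) :
    IsClassicalSolution ν T (synthOmega (cascadeSolution ν (sineDatum c))) (synthOmegaT ν (cascadeSolution ν (sineDatum c)))
      (synthOmegaX (cascadeSolution ν (sineDatum c))) (synthOmegaXX (cascadeSolution ν (sineDatum c))) := by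
  obtain ⟨A, q, hA, hq, hq1, hb⟩ := envelope_of_lt_critical hν hc hlt
  exact isClassicalSolution_synth (isSineCascade_cascadeSolution ν c) hA hq hq1 hb T

/-- **Existence, packaged: for `ν > 0` and `0 ≤ c < κ*ν` there is ONE quadruple with `ω(0,·) = −c sin` which is a classical solution
on `[0, T]` for every `T`** — a global classical solution of the periodic viscous CLM from the sine datum. [new here — MODEL] -/
theorem exists_global_classicalSolution_of_lt_critical (hν : 0 < ν) (hc : 0 ≤ c) (hlt : c < criticalConstant * ν) :
    ∃ ω ωt ωx ωxx : ℝ → ℝ → ℝ, (∀ x, ω 0 x = -c * Real.sin x) ∧ ∀ T : ℝ, IsClassicalSolution ν T ω ωt ωx ωxx :=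
  ⟨_, _, _, _, synthOmega_cascadeSolution_zero c, isClassicalSolution_of_lt_critical hν hc hlt⟩

/-- **Uniqueness / identification below `κ*ν`:** every classical solution on `[0, T]` (`T > 0`) from `−c sin x` with
`0 ≤ c < κ*ν` IS the synthesized global one on `[0, T] × ℝ` (eng-3's `IsClassicalSolution.eq_synth_of_envelope`). [new here — MODEL] -/
theorem eq_synth_of_lt_critical (h : IsClassicalSolution ν T ω ωt ωx ωxx) (hω0 : ∀ x, ω 0 x = -c * Real.sin x)
    (hν : 0 < ν) (hc : 0 ≤ c) (hlt : c < criticalConstant * ν) (hT : 0 < T) {t : ℝ} (ht : t ∈ Icc (0 : ℝ) T) (x : ℝ) :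
    ω t x = synthOmega (cascadeSolution ν (sineDatum c)) t x := by
  obtain ⟨A, q, hA, hq, hq1, hb⟩ := envelope_of_lt_critical hν hc hlt
  exact h.eq_synth_of_envelope hω0 (isSineCascade_cascadeSolution ν c) hA hq hq1 hb hT ht x

/-! ### ABOVE `κ*ν`: no classical solution past `log(c/(8ν))/ν` -/

/-- **FINITE HORIZON ABOVE `κ*ν`, UNIFORM AND EXPLICIT.** For `ν > 0` and `c > κ*ν` every classical `2π`-periodic solution of the
MODEL PDE on `[0, T]` with `ω(0,·) = −c sin` has `T < log(c/(8ν))/ν`: no classical solution exists on `[0, log(c/(8ν))/ν]`.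
(Were one to exist, its cascade variables — which ARE the explicit cascade — would be bounded on the whole window `[0, log(c/(8ν))/ν]`,
and the receding pole makes that bound global in time: `c/ν ≤ κ*`.) [new here — MODEL] -/
theorem horizon_lt_of_critical_lt (h : IsClassicalSolution ν T ω ωt ωx ωxx) (hω0 : ∀ x, ω 0 x = -c * Real.sin x)
    (hν : 0 < ν) (hlt : criticalConstant * ν < c) : T < Real.log (c / (8 * ν)) / ν := by
  rcases le_or_gt T 0 with hT | hT
  · have hc8 : 1 < c / (8 * ν) := by
      rw [lt_div_iff₀ (by positivity)]
      nlinarith [eight_lt_criticalConstant]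
    exact lt_of_le_of_lt hT (div_pos (Real.log_pos hc8) hν)
  · obtain ⟨B, hB⟩ := exists_abs_coef_re_le_uniform h
    refine horizon_lt_of_sine_bound hν hlt (B := B) fun k t ht => ?_
    rw [← coef_re_eq_cascadeSolution h hω0 hT k ht]
    exact (le_abs_self _).trans (hB t ht k)

/-- **No global classical solution above `κ*ν`.** [new here — MODEL] -/
theorem not_global_of_critical_lt (hν : 0 < ν) (hlt : criticalConstant * ν < c) :
    ¬ ∃ ω ωt ωx ωxx : ℝ → ℝ → ℝ, (∀ x, ω 0 x = -c * Real.sin x) ∧ ∀ T : ℝ, IsClassicalSolution ν T ω ωt ωx ωxx := by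
  rintro ⟨ω, ωt, ωx, ωxx, hω0, hall⟩
  exact lt_irrefl _ (horizon_lt_of_critical_lt (hall (Real.log (c / (8 * ν)) / ν)) hω0 hν hlt)

/-- **GLOBAL IFF BELOW THE CRITICAL CONSTANT** (off the critical value itself): for `ν > 0`, `c ≥ 0`, `c ≠ κ*ν`, a global classical
solution from `−c sin x` exists iff `c < κ*ν`. [new here — MODEL] -/
theorem global_iff_lt_critical (hν : 0 < ν) (hc : 0 ≤ c) (hne : c ≠ criticalConstant * ν) :
    (∃ ω ωt ωx ωxx : ℝ → ℝ → ℝ, (∀ x, ω 0 x = -c * Real.sin x) ∧ ∀ T : ℝ, IsClassicalSolution ν T ω ωt ωx ωxx) ↔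
      c < criticalConstant * ν := by
  refine ⟨fun hex => ?_, exists_global_classicalSolution_of_lt_critical hν hc⟩
  rcases lt_or_gt_of_ne hne with hlt | hgt
  · exact hlt
  · exact absurd hex (not_global_of_critical_lt hν hgt)

/-- **Globality is monotone in the amplitude** (a corollary of the dichotomy that does not mention `κ*`): if `−c₂ sin x` has a
global classical solution (`ν > 0`) then so has `−c₁ sin x` for every `0 ≤ c₁ < c₂`. [new here — MODEL] -/
theorem exists_global_of_lt_of_global (hν : 0 < ν) {c₁ c₂ : ℝ} (hc₁ : 0 ≤ c₁) (h12 : c₁ < c₂)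
    (h₂ : ∃ ω ωt ωx ωxx : ℝ → ℝ → ℝ, (∀ x, ω 0 x = -c₂ * Real.sin x) ∧ ∀ T : ℝ, IsClassicalSolution ν T ω ωt ωx ωxx) :
    ∃ ω ωt ωx ωxx : ℝ → ℝ → ℝ, (∀ x, ω 0 x = -c₁ * Real.sin x) ∧ ∀ T : ℝ, IsClassicalSolution ν T ω ωt ωx ωxx := by
  have h₂le : c₂ ≤ criticalConstant * ν := by
    by_contra hcon
    exact not_global_of_critical_lt hν (not_le.mp hcon) h₂
  exact exists_global_classicalSolution_of_lt_critical hν hc₁ (lt_of_lt_of_le h12 h₂le)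

/-- **The general odd class above `κ*ν`.** A classical `2π`-periodic solution on `[0, T]` whose datum has cascade variables
`coef ω k 0 = a_k ∈ ℝ` with `a_k ≥ 0`, zero mean and `a₁ > κ*ν` (`ν > 0`) has `T < log(a₁/(8ν))/ν` (eng-3's finite-horizon comparison
`sine_le_coef_re`: the sine cascade with `c = a₁` sits below the solution's cascade variables). [new here — MODEL] -/
theorem horizon_lt_of_critical_lt_gen (h : IsClassicalSolution ν T ω ωt ωx ωxx) {a : ℕ → ℝ}
    (hdat : ∀ k : ℕ, coef ω k 0 = ((a k : ℝ) : ℂ)) (ha : ∀ k, 0 ≤ a k) (hmean : mode ω 0 0 = 0)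
    (hν : 0 < ν) (hlt : criticalConstant * ν < a 1) : T < Real.log (a 1 / (8 * ν)) / ν := by
  obtain ⟨B, hB⟩ := exists_abs_coef_re_le_uniform h
  refine horizon_lt_of_sine_bound hν hlt (B := B) fun k t ht => ?_
  exact (sine_le_coef_re h hdat ha hmean k t ht).trans ((le_abs_self _).trans (hB t ht k))

/-! ### One citation -/

/-- **THE SHARP-THRESHOLD THEOREM FOR THE SINE DATUM (one citation).** There is ONE constant `κ* = criticalConstant` of the MODEL,
`494/25 ≤ κ* ≤ 1983/100`, such that for every `ν > 0` and `c ≥ 0`: if `c < κ*ν` the MODEL PDE `ω_t = ω·Hω + ν ω_xx` on `𝕋` has a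
GLOBAL classical `2π`-periodic solution from `ω(0,·) = −c sin` (unique on every horizon: `eq_synth_of_lt_critical`); if `c > κ*ν` every
classical solution from that datum has horizon `T < log(c/(8ν))/ν`. The case `c = κ*ν` is not decided. [new here — MODEL] -/
theorem sine_datum_dichotomy {ν c : ℝ} (hν : 0 < ν) (hc : 0 ≤ c) :
    ((494 / 25 : ℝ) ≤ criticalConstant ∧ criticalConstant ≤ 1983 / 100) ∧
    (c < criticalConstant * ν →
      ∃ ω ωt ωx ωxx : ℝ → ℝ → ℝ, (∀ x, ω 0 x = -c * Real.sin x) ∧ ∀ T : ℝ, IsClassicalSolution ν T ω ωt ωx ωxx) ∧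
    (criticalConstant * ν < c → ∀ {T : ℝ} {ω ωt ωx ωxx : ℝ → ℝ → ℝ}, IsClassicalSolution ν T ω ωt ωx ωxx →
      (∀ x, ω 0 x = -c * Real.sin x) → T < Real.log (c / (8 * ν)) / ν) :=
  ⟨⟨le_criticalConstant, criticalConstant_le⟩, exists_global_classicalSolution_of_lt_critical hν hc,
    fun hlt _ _ _ _ _ h hω0 => horizon_lt_of_critical_lt h hω0 hν hlt⟩

end SheetNSLineTorusCascade
end Summit.NavierStokesRegularity.OSWSelfSimilar
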